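import Mathlib.MeasureTheory.Measure.Haar.NormedSpace
import Mathlib.Analysis.InnerProductSpace.PiL2
import HarnessLib

/-!
# Barrier: a fixed-scale regularisation is covariant under the Navier–Stokes dilation only with a
# RESCALED regularisation parameter (`γ ↦ γα`) — «regularise, bound, rescale the data, let α → ∞»
# transports nothing

Barrier catalogue entry for `NavierStokesRegularity` (D-0021), METHOD LEVEL, everything PROVED (zero fact
debt), filed by the D-0090 NS-CLAIMS cell (salvage seat `ns-claims-salvage-p2`) for the technique class
«regularised equation + a-priori bound with a regularisation-dependent constant + scaling of the data»
(cell MAP-SCHEMA T1 × T12/scaling). Adjudicated instance: C20, G. Jennings, arXiv:2002.08270 v6, Lemma 9.1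
(9.4)–(9.7) p.109–110 (skeleton `Literature.Claims.NS.Jennings2020`, first failing step `Step6b_JDilation`,
kernel refutation `Summit.…Theorems.Jennings2020.not_Step6b_JDilation`; the companion projector step
`Step6c_PlDilation` is TRUE, `…Theorems.Jennings2020.step6c_holds`).

## What is printed

* The Navier–Stokes dilation: `u_λ(t,x) = λ u(λ²t, λx)` maps solutions to solutions and data to data
  (Lemarié-Rieusset 2016, §20.2, p. 708: «`u⃗_λ(t,x) = λ u⃗(λ²t, λx)`»); every scale-free estimate is
  transported along it, and letting `λ → ∞` or `λ → 0` is the standard device for removing inhomogeneous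
  constants. [LemarieRieusset2016]
* Regularised (mollified) Navier–Stokes systems `∂ₜu + P[(J_ε u·∇)(J_ε u)] = ν J_ε²Δu` (Majda–Bertozzi 2002,
  §3.2, eq. (3.41) ff.): for each FIXED `ε > 0` an ODE in `H^m` with global solutions and `ε`-DEPENDENT bounds;
  the regularity problem is the passage `ε → 0` with `ε`-UNIFORM bounds (ibid., §3.2.2). [MajdaBertozziCUP2002]
* Scale-COVARIANT regularisations do transport: hyperdissipation `(−Δ)^β` changes the amplitude exponent of
  the dilation and is globally regular for `β ≥ 5/4` (Lions 1969, Ch. I Rem. 6.11; Tao 2009, §1). [Lions1969]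
  [Tao2009]
* The adjudicated instance asserts (9.5)→(9.6), p.110: `J_γ[x ↦ α u(xα)] = x ↦ α (J_γ u)(xα)` at FIXED
  `γ > 0`, and uses it to move the `γ`-dependent bound (8.22) along `α → ∞`. [Jennings2020]

## What is formalised

For a kernel `m : E → ℝ` on a finite-dimensional real normed space `E` (Haar measure `volume`), the
rescaled kernels `m_γ(y) = γ^{-d} m(y/γ)` (`d = dim E`), the mollifier `J_γ v (x) = ∫ m_γ(y) v(x − y) dy`
(Bochner; NO integrability hypothesis anywhere — the identities are junk-consistent), and the dilation
`(δ_α v)(x) = α v(αx)`: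

* `mollify_dilate` / `mollify_comp_dilate`: **`J_γ (δ_α v) = δ_α (J_{γα} v)`** for `γ ≠ 0`, `α > 0` — the
  dilation CONJUGATES the scale-`γ` mollifier into the scale-`γα` mollifier (Haar change of variables
  `Measure.integral_comp_smul`). Hence `J_γ` commutes with `δ_α` on a field `v` iff `J_γ v = J_{γα} v` along
  the orbit — false for every `v` that the two mollifiers smooth differently (the C20 witness: a bump).

WHAT THIS IS NOT: not a claim about NS regularity or blow-up; not a claim about any author beyond the
typed locator.
-/

noncomputable section

open MeasureTheory Set Function Module

namespace Literature.Barriers.NavierStokesRegularity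

variable {E : Type*} [NormedAddCommGroup E] [NormedSpace ℝ E] [MeasureSpace E] [BorelSpace E]
  [FiniteDimensional ℝ E] [(volume : Measure E).IsAddHaarMeasure]
variable {F : Type*} [NormedAddCommGroup F] [NormedSpace ℝ F]

/-- The rescaled kernel `m_γ(y) = γ^{-d} m(γ⁻¹ y)`, `d = dim E` (Majda–Bertozzi 2002 §3.2, the mollifier
`J_ε`; the instance `Literature.Claims.NS.Jennings2020.mGam` has `d = 3`).
[cite: MajdaBertozziCUP2002, §3.2 (mollifiers J_ε)] -/
def kernelRescale (m : E → ℝ) (γ : ℝ) (y : E) : ℝ :=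
  (γ⁻¹) ^ finrank ℝ E * m (γ⁻¹ • y)

/-- The mollifier `J_γ v (x) = ∫ m_γ(y) v(x − y) dy` (Bochner integral; junk value `0` off `L¹`, harmless for
the identities below). [cite: MajdaBertozziCUP2002, §3.2 (mollifiers J_ε)] -/
def mollify (m : E → ℝ) (γ : ℝ) (v : E → F) (x : E) : F :=
  ∫ y, kernelRescale m γ y • v (x - y)

/-- The Navier–Stokes dilation of a field at fixed time, `(δ_α v)(x) = α v(αx)` (Lemarié-Rieusset 2016
§20.2: `u_λ(t,x) = λu(λ²t,λx)`; data `u₀ ↦ λu₀(λ·)`). [cite: LemarieRieusset2016, §20.2 p. 708] -/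
def dilate (α : ℝ) (v : E → F) (x : E) : F :=
  α • v (α • x)

omit [MeasureSpace E] [BorelSpace E] [FiniteDimensional ℝ E] [(volume : Measure E).IsAddHaarMeasure] in
/-- Rescaled kernels compose multiplicatively in the scale: `m_{γα}(αy) = α^{-d} m_γ(y)`.
[cite: MajdaBertozziCUP2002, §3.2 (mollifiers J_ε)] -/
theorem kernelRescale_mul_smul (m : E → ℝ) {γ α : ℝ} (hγ : γ ≠ 0) (hα : α ≠ 0) (y : E) :
    kernelRescale m (γ * α) (α • y) = (α⁻¹) ^ finrank ℝ E * kernelRescale m γ y := by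
  unfold kernelRescale
  rw [mul_inv, smul_smul, show γ⁻¹ * α⁻¹ * α = γ⁻¹ by field_simp, mul_pow]
  ring

/-- **The dilation conjugates `J_γ` into `J_{γα}`** (pointwise form): for `γ ≠ 0`, `α > 0`, every kernel `m`
and every field `v`, `J_γ[x ↦ α v(αx)](x) = α · (J_{γα} v)(αx)`. Haar change of variables `y = α⁻¹z`
(`Measure.integral_comp_smul`); no integrability hypothesis. This is the covariance that DOES hold; the one
asserted at fixed `γ` in the adjudicated instance (Jennings 2020, (9.5)→(9.6) p.110) replaces `J_{γα}` by `J_γ`.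
[cite: Jennings2020, L9.1 (9.5)–(9.6) p.110] [cite: LemarieRieusset2016, §20.2 p. 708] -/
theorem mollify_dilate (m : E → ℝ) {γ α : ℝ} (hγ : γ ≠ 0) (hα : 0 < α) (v : E → F) (x : E) :
    mollify m γ (dilate α v) x = α • mollify m (γ * α) v (α • x) := by
  have hαne : α ≠ 0 := hα.ne'
  set d : ℕ := finrank ℝ E with hd
  unfold mollify dilate
  -- the substituted integrand
  set G : E → F := fun z => kernelRescale m (γ * α) z • v (α • x - z) with hG
  have hpt : ∀ y : E, kernelRescale m γ y • (α • v (α • (x - y))) = (α * α ^ d) • G (α • y) := by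
    intro y
    simp only [hG, kernelRescale_mul_smul m hγ hαne, smul_sub, smul_smul]
    congr 1
    rw [hd, inv_pow]
    field_simp
  simp_rw [hpt]
  rw [integral_smul, Measure.integral_comp_smul volume G α, smul_smul, ← hd, abs_inv,
    abs_of_pos (pow_pos hα d), show α * α ^ d * (α ^ d)⁻¹ = α by field_simp]

/-- **The dilation conjugates `J_γ` into `J_{γα}`** (operator form): `J_γ ∘ δ_α = δ_α ∘ J_{γα}` on every field,
`γ ≠ 0`, `α > 0`. Consequently an a-priori bound proved for the `γ`-regularised system with a `γ`-dependent
constant, applied to the dilated datum `δ_α u₀` at the SAME `γ` and pulled back along the dilation, is the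
bound for `u₀` at regularisation scale `γα` — letting `α → ∞` (or `0`) is the degenerate-regularisation limit,
not a constant-killing device. [cite: LemarieRieusset2016, §20.2 p. 708] [cite: MajdaBertozziCUP2002, §3.2.2] -/
theorem mollify_comp_dilate (m : E → ℝ) {γ α : ℝ} (hγ : γ ≠ 0) (hα : 0 < α) (v : E → F) :
    mollify m γ (dilate α v) = dilate α (mollify m (γ * α) v) := by
  funext x
  exact mollify_dilate m hγ hα v x

/-- **Barrier (method level): fixed-scale regularisation is not invariant under the Navier–Stokes dilation;
it is covariant only with the rescaled parameter `γ ↦ γα`.**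
This declaration is the operator identity `∀ γ ≠ 0, ∀ α > 0, J_γ ∘ δ_α = δ_α ∘ J_{γα}` for every kernel on every
finite-dimensional space (the tree theorem `mollify_comp_dilate`).

BARRIER (structured block, D-0021):
technique_class: regularise-then-rescale fixed-scale-mollifier mollified-navier-stokes a-priori-bound-with-regularisation-constant data-dilation alpha-to-infinity vanishing-regularisation-transfer sup-norm-identity-by-scaling
blocks: every argument of the shape «(1) regularise the nonlinearity (or the equation) at a FIXED length scale `γ > 0`; (2) prove a bound for the regularised solutions whose constant depends on `γ` (e.g. through `‖m_γ‖_{L²} ∼ γ^{-d/2}`); (3) apply it to the dilated data `δ_α u₀ = α u₀(α·)` at the same `γ` and pull back with the dilation `u ↦ α u(α²t, αx)`; (4) let `α → ∞` or `α → 0` so that the constant disappears, obtaining a scale-free bound (in C20: `‖u^γ‖_{L^∞L^∞} ≤ ‖u₀‖_∞`, then `γ → 0`)» — step (3) silently uses `J_γ ∘ δ_α = δ_α ∘ J_γ`, which is false; the true identity `J_γ ∘ δ_α = δ_α ∘ J_{γα}` (this declaration) turns step (4) into the limit of VANISHING or INFINITE regularisation, where the constant of step (2) degenerates exactly as fast as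 it was supposed to disappear [cite: Jennings2020, L9.1 (9.4)–(9.7) p.109–110 and T9.2 (9.11) p.111–112].
because: the dilation group acts on the regularisation parameter — by the Haar change of variables `∫ m_γ(y) α v(α(x−y)) dy = α ∫ m_{γα}(z) v(αx − z) dz` [cite: LemarieRieusset2016, §20.2 p. 708] — so the regularised systems `{NS_γ}_γ` form ONE orbit and no member is a fixed point; scale-free information can only come from bounds UNIFORM in `γ`, which is the regularity problem itself (Majda–Bertozzi: the whole difficulty of §3.2.2 is the `ε`-independent estimate) [cite: MajdaBertozziCUP2002, §3.2.2].
evasions_known: (1) scale-COVARIANT regularisations — hyperdissipation `(−Δ)^β` is transported by the dilation with a modified amplitude exponent, and there the transfer is honest: global regularity holds for `β ≥ 5/4` (Lions 1969) and slightly below in the logarithmic scale (Tao 2009) [cite: Lions1969, Ch. I Rem. 6.11] [cite: Tao2009, §1]; (2) bounds for `NS_γ` that are uniform in `γ` (energy class only: Leray–Hopf) transfer, but are supercritical (tree barrier `EnergySupercriticality`); nothing critical or subcritical is known to be `γ`-uniform.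
scope_caveats: (a) the identity is stated for convolution mollifiers `m_γ = γ^{-d}m(·/γ)` acting componentwise on fields with values in any real normed space, on any finite-dimensional real normed space with its Haar measure; Fourier cut-offs `P_{≤N}` behave identically (`N ↦ N/α`) but are not formalised here; (b) the statement is kinematic (no equation is involved): it constrains every scheme of the blocked shape regardless of which regularised system is used, as long as the regularisation has a length scale; (c) the degree-zero part of such schemes (Leray projector, Riesz transforms) IS dilation-covariant — cf. the cell theorem `Summit.…Theorems.Jennings2020.step6c_holds` — so the failure localises entirely in the scale-carrying operator.
status: established; proved in the tree (`regularisationScaleCovariance_holds`, standard axioms)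
[cite: LemarieRieusset2016, §20.2 p. 708] [cite: MajdaBertozziCUP2002, §3.2 (mollifiers J_ε) and §3.2.2] -/
def RegularisationScaleCovariance : Prop :=
  ∀ (E : Type) [NormedAddCommGroup E] [NormedSpace ℝ E] [MeasureSpace E] [BorelSpace E]
    [FiniteDimensional ℝ E] [(volume : Measure E).IsAddHaarMeasure] (F : Type) [NormedAddCommGroup F]
    [NormedSpace ℝ F] (m : E → ℝ) (γ α : ℝ), γ ≠ 0 → 0 < α → ∀ v : E → F,
      mollify m γ (dilate α v) = dilate α (mollify m (γ * α) v)

/-- **The barrier holds** (`mollify_comp_dilate`). [cite: LemarieRieusset2016, §20.2 p. 708] -/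
theorem regularisationScaleCovariance_holds : RegularisationScaleCovariance :=
  fun _E _ _ _ _ _ _ _F _ _ m _γ _α hγ hα v => mollify_comp_dilate m hγ hα v

end Literature.Barriers.NavierStokesRegularity
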